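import Summits.CriticalPhenomena.PercolationContinuityZ3.Theorems.PercNearOneGluingNoHeavyQuantJointBlobHull
import Summits.CriticalPhenomena.PercolationContinuityZ3.Theorems.PercNearOneGluingNoHeavyQuantGatedProductHull
import HarnessLib

/-!
# QUANT lane R8, T-DEC: THE GATED BLOB HULL — membership `LawDec.InGatedBlobHull y T M μ` (mixtures of laws `gate (blobLaw l) s`
# of a common mean `T` whose relays all sit at marginal `≥ y`), its DEC / SDEC consequences, and the per-outer-gate RESIDUAL API
# `decAt_gate_of_gatedBlobResidual` (a gated forest law `gate F a = w·P + (1−w)·R` is DEC at `(a·x, every layer)` as soon as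
# `P` is DEC at the target and `R` lies in the gated blob hull)

builds on p205010 (kernel theorem, internal audit signed; external expert review pending)

Support + definition file (`--supports stmt-CriticalPhenomena-4575`), QUANT lane seat prim-quant-census-1 (gen 23); memo
`run/shared/lean/prim/quant/prim-quant-census-1/TOPEXP-G23.md`.  One definition (`LawDec.InGatedBlobHull`); theorems with standard
axioms, no sorries.  Continues typer g40's `…QuantJointBlobHull` (`InBlobHull`, `sdec_blobLaw`, `sdec_of_inBlobHull`) and typer g35's
`…QuantGatedProductHull` (`decAtT_gate_of_gatedSDEC`, `sdec_of_gatedSDECMixture`).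

WHY.  Lead g46's per-level picture (README V428/V429) reads the sibling step at an outer gate `a < 1` through the TOP-LEVEL EXPANSION
`gate_a(F) = w(a)·P_a + (1 − w(a))·R_a` (`P_a` = the siblings with every root gate scaled by `a`, DEC by `convClosedT_holds` and the
oracle; `R_a ≥ 0` an explicit residual law of the same mean `a·m`).  The census of this seat (memo §3; kit j247913, exact rational
certificates from an engine written independently of the lane's `kit/rcmA`) finds that on the lane's named instances the residual
`R_a` — and, for `a` below a threshold close to `1`, the target `gate_a(F)` itself — is a mixture of GATED BLOB FORESTS
`gate_{a'}(blobLaw l)` with `a'·blobMean l = a·m` and every relay marginal `a'·gᵢ ≥ a·x` (e.g. census-2 g73's witness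
`(R¹[19/20](R²[1/2]))³` at `a = 99/100`: eight such columns, no re-tuned product — correcting V429's 'type A necessary at a = .99',
an artefact of the blob menu of `kit/rcmA`; and its limit residual `R₁` likewise).  The UNGATED blob hull `InBlobHull` (README V423's
`K_x(m)`) is refuted as a node (V424–V427); the gated hull is the certificate family the programme (I)/(II) of V428 actually uses at
`a < 1`.  This file supplies its kernel API — nothing here is a conjecture:
* `LawDec.InGatedBlobHull y T M μ`: `μ = Σᵢ wᵢ · gate (blobLaw lᵢ) sᵢ`, `w ≥ 0`, `Σ w = 1`, `y < sᵢ ≤ 1`, every blob gate `g` of `lᵢ` with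
  `y ≤ sᵢ·g` and `g ≤ 1`, `blobTop lᵢ ≤ M`, `sᵢ · blobMean lᵢ = T`.
* `InGatedBlobHull.lawFacts` (nonnegative, vanishing above `M`, mass `1`, mean `T`), `inGatedBlobHull_of_inBlobHull` (`s ≡ 1`),
  `InGatedBlobHull.mix` (convexity), `inGatedBlobHull_gate` (stability under a further outer gate `0 < q ≤ 1`: floor and mean scale by `q`).
* **`decAtT_of_inGatedBlobHull`**: a member is DEC at floor `y`, target `T`, top `M`, at EVERY layer (`sdec_blobLaw` at floor `y/sᵢ`,
  `decAtT_gate_of_gatedSDEC`, `decAtT_finite_mixture`); **`sdec_of_inGatedBlobHull`**: a member at floor `x` of its own mean is `SDEC x M`.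
* **`decAt_gate_of_gatedBlobResidual`** (the per-outer-gate residual API): if `gate F a = w·P + (1−w)·R` pointwise with `0 ≤ w ≤ 1`,
  `P` DEC at `(y, T, j, M)` and `InGatedBlobHull y T M R`, then `gate F a` is DEC at `(y, T, j, M)`; with `T` the mean of `gate F a`
  this is `DECAt y j M G` (`decAt_of_gatedBlobResidual`, `decAt_gate_of_gatedBlobResidual`).

HONEST STATUS: certificate-family infrastructure only; `SiblingStep`, `GateStepN`, `FarTreeRow` OPEN; the census statement 'R_a lies in
the gated blob hull' is EVIDENCE (exact instances), not a theorem and not typed here.  RATE class log\* / honest sentence of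
`run/shared/lean/prim/quant/README.md` unchanged.  [this work]; `InBlobHull`/`sdec_blobLaw`: prim-quant-stmt g40; `decAtT_gate_of_gatedSDEC`:
prim-quant-stmt g35; top-level expansion: prim-quant-lead g46 (V428), list-binder form prim-quant-arm-1 g48.  Nothing here is cited as
a published result.  The gluing rows served [cite: KozmaNitzan2024, Conjecture 3 (p. 15)]; product measure [cite: Grimmett1999, §1.3 p. 10].
-/

noncomputable section

open scoped BigOperators

namespace Summit.CriticalPhenomena.PercolationContinuityZ3.Theorems
namespace Quant
namespace LawDec

open Finset

/-! ### The gated blob hull -/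

/-- **Membership in the GATED BLOB HULL at floor `y`, target mean `T`, top `M`**: `μ` on `{0..M}` is a finite mixture
`μ = Σᵢ wᵢ · gate (blobLaw lᵢ) sᵢ` of GATED laws of independent heavy blobs — outer gates `y < sᵢ ≤ 1`, every blob gate `g` of `lᵢ` with
`y ≤ sᵢ·g` (all relay marginals of the column are `≥ y`) and `g ≤ 1`, tops `blobTop lᵢ ≤ M`, and every column of mean EXACTLY `T`
(`sᵢ · blobMean lᵢ = T`). [this work] -/
def InGatedBlobHull (y T : ℝ) (M : ℕ) (μ : ℕ → ℝ) : Prop :=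
  ∃ (ι : Type) (_ : Fintype ι) (w s : ι → ℝ) (l : ι → List (ℕ × ℝ)),
    (∀ i, 0 ≤ w i) ∧ ∑ i, w i = 1 ∧ (∀ i, y < s i ∧ s i ≤ 1) ∧ (∀ i, ∀ p ∈ l i, y ≤ s i * p.2 ∧ p.2 ≤ 1) ∧
    (∀ i, blobTop (l i) ≤ M) ∧ (∀ i, s i * blobMean (l i) = T) ∧ ∀ h, μ h = ∑ i, w i * gate (blobLaw (l i)) (s i) h

/-- the blob gates of a gated column lie in `[y / s, 1]` and are nonnegative when `0 ≤ y`. [this work] -/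
theorem InGatedBlobHull.gates_div {y : ℝ} {s : ℝ} {l : List (ℕ × ℝ)} (hs : y < s) (hy : 0 ≤ y)
    (hl : ∀ p ∈ l, y ≤ s * p.2 ∧ p.2 ≤ 1) : ∀ p ∈ l, y / s ≤ p.2 ∧ p.2 ≤ 1 := by
  intro p hp
  have hs0 : 0 < s := lt_of_le_of_lt hy hs
  refine ⟨?_, (hl p hp).2⟩
  rw [div_le_iff₀ hs0, mul_comm]
  exact (hl p hp).1

/-- **law facts of a gated-hull member** (`0 ≤ y`): nonnegative, vanishing above `M`, mass `1`, mean `T`. [this work] -/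
theorem InGatedBlobHull.lawFacts {y T : ℝ} {M : ℕ} {μ : ℕ → ℝ} (h : InGatedBlobHull y T M μ) (hy : 0 ≤ y) :
    (∀ k, 0 ≤ μ k) ∧ (∀ k, M < k → μ k = 0) ∧ ∑ k ∈ Finset.range (M + 1), μ k = 1 ∧
      ∑ k ∈ Finset.range (M + 1), (k : ℝ) * μ k = T := by
  obtain ⟨ι, hι, w, s, l, hw0, hw1, hs, hg, htop, hmean, hmix⟩ := h
  have hg' : ∀ i, ∀ p ∈ l i, 0 ≤ p.2 ∧ p.2 ≤ 1 := fun i p hp =>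
    ⟨(div_nonneg hy (hy.trans (hs i).1.le)).trans (InGatedBlobHull.gates_div (hs i).1 hy (hg i) p hp).1, (hg i p hp).2⟩
  have hs0 : ∀ i, 0 ≤ s i := fun i => hy.trans (hs i).1.le
  have G : ∀ i, (∀ k, 0 ≤ gate (blobLaw (l i)) (s i) k) ∧ (∀ k, M < k → gate (blobLaw (l i)) (s i) k = 0) ∧
      ∑ k ∈ Finset.range (M + 1), gate (blobLaw (l i)) (s i) k = 1 := fun i =>
    gate_laws M (blobLaw (l i)) (s i) (hs0 i) (hs i).2 (blobLaw_nonneg (l i) (hg' i))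
      (fun k hk => blobLaw_eq_zero (l i) k (lt_of_le_of_lt (htop i) hk)) (sum_blobLaw_of_le (l i) (htop i))
  refine ⟨fun k => ?_, fun k hk => ?_, ?_, ?_⟩
  · rw [hmix k]; exact Finset.sum_nonneg fun i _ => mul_nonneg (hw0 i) ((G i).1 k)
  · rw [hmix k]; exact Finset.sum_eq_zero fun i _ => by rw [(G i).2.1 k hk, mul_zero]
  · simp_rw [hmix]
    rw [Finset.sum_comm]
    have e : ∀ i, ∑ k ∈ Finset.range (M + 1), w i * gate (blobLaw (l i)) (s i) k = w i := fun i => by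
      rw [← Finset.mul_sum, (G i).2.2, mul_one]
    simp_rw [e]; exact hw1
  · have e0 : ∀ k : ℕ, (k : ℝ) * μ k = ∑ i, w i * ((k : ℝ) * gate (blobLaw (l i)) (s i) k) := fun k => by
      rw [hmix k, Finset.mul_sum]; exact Finset.sum_congr rfl fun i _ => by ring
    simp_rw [e0]
    rw [Finset.sum_comm]
    have e : ∀ i, ∑ k ∈ Finset.range (M + 1), w i * ((k : ℝ) * gate (blobLaw (l i)) (s i) k) = w i * T := fun i => by
      rw [← Finset.mul_sum, sum_mul_gate, sum_mul_blobLaw_of_le (l i) (htop i), hmean i]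
    simp_rw [e]
    rw [← Finset.sum_mul, hw1, one_mul]

/-- **the ungated blob hull lies in the gated one** (`s ≡ 1`; floor `x < 1`). [this work] -/
theorem inGatedBlobHull_of_inBlobHull {x m : ℝ} {M : ℕ} {μ : ℕ → ℝ} (h : InBlobHull x m M μ) (hx1 : x < 1) :
    InGatedBlobHull x m M μ := by
  obtain ⟨ι, hι, w, l, hw0, hw1, hg, htop, hmean, hmix⟩ := h
  refine ⟨ι, hι, w, fun _ => 1, l, hw0, hw1, fun _ => ⟨hx1, le_rfl⟩, fun i p hp => ?_, htop, fun i => ?_, fun h => ?_⟩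
  · rw [one_mul]; exact hg i p hp
  · rw [one_mul]; exact hmean i
  · rw [hmix h]; exact Finset.sum_congr rfl fun i _ => by rw [gate_one]

/-- **a single gated blob column lies in the gated hull.** [this work] -/
theorem inGatedBlobHull_gate_blobLaw (y s : ℝ) (l : List (ℕ × ℝ)) (hs : y < s ∧ s ≤ 1) (hl : ∀ p ∈ l, y ≤ s * p.2 ∧ p.2 ≤ 1)
    {M : ℕ} (hM : blobTop l ≤ M) : InGatedBlobHull y (s * blobMean l) M (gate (blobLaw l) s) :=
  ⟨Unit, inferInstance, fun _ => 1, fun _ => s, fun _ => l, fun _ => zero_le_one, by simp, fun _ => hs, fun _ => hl, fun _ => hM,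
    fun _ => rfl, fun h => by simp⟩

/-- **convexity** of the gated hull. [this work] -/
theorem InGatedBlobHull.mix {y T t : ℝ} {M : ℕ} {μ ν : ℕ → ℝ} (hμ : InGatedBlobHull y T M μ) (hν : InGatedBlobHull y T M ν)
    (ht0 : 0 ≤ t) (ht1 : t ≤ 1) : InGatedBlobHull y T M (fun h => t * μ h + (1 - t) * ν h) := by
  obtain ⟨ι₁, hι₁, w₁, s₁, l₁, hw0₁, hw1₁, hs₁, hg₁, htop₁, hmean₁, hmix₁⟩ := hμ
  obtain ⟨ι₂, hι₂, w₂, s₂, l₂, hw0₂, hw1₂, hs₂, hg₂, htop₂, hmean₂, hmix₂⟩ := hν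
  refine ⟨ι₁ ⊕ ι₂, inferInstance, Sum.elim (fun i => t * w₁ i) (fun j => (1 - t) * w₂ j), Sum.elim s₁ s₂, Sum.elim l₁ l₂,
    ?_, ?_, ?_, ?_, ?_, ?_, fun h => ?_⟩
  · rintro (i | j)
    · exact mul_nonneg ht0 (hw0₁ i)
    · exact mul_nonneg (by linarith) (hw0₂ j)
  · rw [Fintype.sum_sum_type]
    simp only [Sum.elim_inl, Sum.elim_inr]
    rw [← Finset.mul_sum, ← Finset.mul_sum, hw1₁, hw1₂]; ring
  · rintro (i | j)
    · exact hs₁ i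
    · exact hs₂ j
  · rintro (i | j)
    · exact hg₁ i
    · exact hg₂ j
  · rintro (i | j)
    · exact htop₁ i
    · exact htop₂ j
  · rintro (i | j)
    · exact hmean₁ i
    · exact hmean₂ j
  · rw [Fintype.sum_sum_type]
    simp only [Sum.elim_inl, Sum.elim_inr]
    rw [hmix₁ h, hmix₂ h, Finset.mul_sum, Finset.mul_sum]
    refine congrArg₂ (· + ·) (Finset.sum_congr rfl fun i _ => by ring) (Finset.sum_congr rfl fun j _ => by ring)

/-- **the gated hull is stable under a further outer gate** `0 < q ≤ 1`: floor and target scale by `q` (gates compose, `gate_gate`;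
the mixture commutes with gating, `gate_mixture`). [this work] -/
theorem inGatedBlobHull_gate {y T : ℝ} {M : ℕ} {μ : ℕ → ℝ} (h : InGatedBlobHull y T M μ) (hy : 0 ≤ y) (q : ℝ) (hq0 : 0 < q)
    (hq1 : q ≤ 1) : InGatedBlobHull (q * y) (q * T) M (gate μ q) := by
  obtain ⟨ι, hι, w, s, l, hw0, hw1, hs, hg, htop, hmean, hmix⟩ := h
  refine ⟨ι, hι, w, fun i => q * s i, l, hw0, hw1, fun i => ⟨?_, ?_⟩, fun i p hp => ⟨?_, (hg i p hp).2⟩, htop, fun i => ?_,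
    fun k => ?_⟩
  · exact mul_lt_mul_of_pos_left (hs i).1 hq0
  · have hs0 : 0 ≤ s i := hy.trans (hs i).1.le
    nlinarith [(hs i).2, hs0]
  · have := (hg i p hp).1
    have h2 : q * y ≤ q * (s i * p.2) := mul_le_mul_of_nonneg_left this hq0.le
    linarith [h2]
  · rw [mul_assoc, hmean i]
  · rw [gate_mixture w (fun i => gate (blobLaw (l i)) (s i)) q hw1 μ hmix k]
    exact Finset.sum_congr rfl fun i _ => by rw [gate_gate]

/-! ### DEC and SDEC consequences -/

/-- **A MEMBER OF THE GATED BLOB HULL IS DEC AT ITS FLOOR AND TARGET, AT EVERY LAYER**: each column `gate (blobLaw l) s` is the gate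
by `s` of a blob law that is SDEC at floor `y/s` (`sdec_blobLaw`) and top-affordable there (`floor_mul_blobTop_le`), hence DEC at
`(y, s·blobMean l = T, j, M)` for every `j` (`decAtT_gate_of_gatedSDEC` with the trivial further gate `1`); mixtures at a common target
are DEC (`decAtT_finite_mixture`). [this work] -/
theorem decAtT_of_inGatedBlobHull {y T : ℝ} {M : ℕ} {μ : ℕ → ℝ} (hy0 : 0 < y) (h : InGatedBlobHull y T M μ) (j : ℕ) :
    DECAtT y T j M μ := by
  obtain ⟨ι, hι, w, s, l, hw0, hw1, hs, hg, htop, hmean, hmix⟩ := h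
  refine decAtT_finite_mixture y T j M μ w (fun i => gate (blobLaw (l i)) (s i)) hw0 hw1 hmix fun i _ => ?_
  have hs0 : 0 < s i := hy0.trans (hs i).1
  have hgd : ∀ p ∈ l i, y / s i ≤ p.2 ∧ p.2 ≤ 1 := InGatedBlobHull.gates_div (hs i).1 hy0.le (hg i)
  have hg' : ∀ p ∈ l i, 0 ≤ p.2 ∧ p.2 ≤ 1 := fun p hp => ⟨(div_pos hy0 hs0).le.trans (hgd p hp).1, (hgd p hp).2⟩
  have hys0 : 0 < y / s i := div_pos hy0 hs0
  have hys1 : y / s i < 1 := by rw [div_lt_one hs0]; exact (hs i).1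
  have hsd : SDEC (y / s i) (blobTop (l i)) (blobLaw (l i)) := sdec_blobLaw (y / s i) hys0 hys1 (l i) hgd
  have hta : y / s i * (blobTop (l i) : ℝ) ≤ ∑ h ∈ Finset.range (blobTop (l i) + 1), (h : ℝ) * blobLaw (l i) h := by
    rw [sum_mul_blobLaw]; exact floor_mul_blobTop_le (y / s i) (l i) fun p hp => (hgd p hp).1
  have key := decAtT_gate_of_gatedSDEC y (s i) (blobTop (l i)) M (blobLaw (l i)) hy0 (hs i).1 (hs i).2
    (blobLaw_nonneg (l i) hg') (fun h hh => blobLaw_eq_zero (l i) h hh) (sum_blobLaw (l i)) hta hsd (htop i)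
    1 one_pos le_rfl j
  rw [one_mul, sum_mul_blobLaw, hmean i, one_mul, gate_one] at key
  exact key

/-- **A MEMBER OF THE GATED BLOB HULL AT ITS OWN MEAN IS DEC(j) AT FLOOR `y` FOR EVERY LAYER `j`.** [this work] -/
theorem decAt_of_inGatedBlobHull {y T : ℝ} {M : ℕ} {μ : ℕ → ℝ} (hy0 : 0 < y) (h : InGatedBlobHull y T M μ) (j : ℕ) :
    DECAt y j M μ := by
  rw [decAt_iff_decAtT, (h.lawFacts hy0.le).2.2.2]
  exact decAtT_of_inGatedBlobHull hy0 h j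

/-- **A MEMBER OF THE GATED BLOB HULL AT FLOOR `x < 1` IS SDEC AT `x`** (the hull is gate-stable, `inGatedBlobHull_gate`). [this work] -/
theorem sdec_of_inGatedBlobHull {x T : ℝ} {M : ℕ} {μ : ℕ → ℝ} (hx0 : 0 < x) (h : InGatedBlobHull x T M μ) : SDEC x M μ := by
  intro q hq0 hq1 j _
  exact decAt_of_inGatedBlobHull (mul_pos hq0 hx0) (inGatedBlobHull_gate h hx0.le q hq0 hq1) j

/-! ### The per-outer-gate residual API -/

/-- **THE RESIDUAL API (target form).**  If a law `G` on `{0..M}` splits pointwise as `G = w·P + (1 − w)·R` with `0 ≤ w ≤ 1`, `P` DEC at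
`(y, T, j, M)` and `R` in the gated blob hull `InGatedBlobHull y T M R` (`0 < y`), then `G` is DEC at `(y, T, j, M)`.  Use: `G = gate (flaw L) a`
(a forest of gated trees under the outer gate `a`), `P = flaw` of the root-scaled siblings (DEC by `convClosedT_holds` and the oracle of the
sibling step), `R` the top-level residual (lead g46 V428; arm-1 g48's `resid`), `y = a·x`, `T = a·fmean L`. [this work] -/
theorem decAtT_of_gatedBlobResidual {y T w : ℝ} {j M : ℕ} {G P R : ℕ → ℝ} (hy0 : 0 < y) (hw0 : 0 ≤ w) (hw1 : w ≤ 1)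
    (hP : DECAtT y T j M P) (hR : InGatedBlobHull y T M R) (hid : ∀ h, G h = w * P h + (1 - w) * R h) :
    DECAtT y T j M G := by
  have e : G = fun h => w * P h + (1 - w) * R h := funext hid
  rw [e]
  exact decAtT_mixture w hw0 hw1 hP (decAtT_of_inGatedBlobHull hy0 hR j)

/-- **THE RESIDUAL API (law form).**  As `decAtT_of_gatedBlobResidual`, concluding `DECAt y j M G` when `T` is the mean of `G` on `{0..M}`.
[this work] -/
theorem decAt_of_gatedBlobResidual {y T w : ℝ} {j M : ℕ} {G P R : ℕ → ℝ} (hy0 : 0 < y) (hw0 : 0 ≤ w) (hw1 : w ≤ 1)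
    (hP : DECAtT y T j M P) (hR : InGatedBlobHull y T M R) (hid : ∀ h, G h = w * P h + (1 - w) * R h)
    (hT : ∑ h ∈ Finset.range (M + 1), (h : ℝ) * G h = T) : DECAt y j M G := by
  rw [decAt_iff_decAtT, hT]
  exact decAtT_of_gatedBlobResidual hy0 hw0 hw1 hP hR hid

/-- **THE RESIDUAL API FOR A GATED LAW.**  For a law `F` on `{0..M}` of mass `1` and mean `m` and an outer gate `a`: if
`gate F a = w·P + (1−w)·R` pointwise with `0 ≤ w ≤ 1`, `P` DEC at `(y, a·m, j, M)` and `InGatedBlobHull y (a·m) M R`, then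
`DECAt y j M (gate F a)` (the mean of `gate F a` is `a·m`, `sum_mul_gate`). [this work] -/
theorem decAt_gate_of_gatedBlobResidual {y w a m : ℝ} {j M : ℕ} {F P R : ℕ → ℝ} (hy0 : 0 < y) (hw0 : 0 ≤ w) (hw1 : w ≤ 1)
    (hm : ∑ h ∈ Finset.range (M + 1), (h : ℝ) * F h = m)
    (hP : DECAtT y (a * m) j M P) (hR : InGatedBlobHull y (a * m) M R) (hid : ∀ h, gate F a h = w * P h + (1 - w) * R h) :
    DECAt y j M (gate F a) :=
  decAt_of_gatedBlobResidual hy0 hw0 hw1 hP hR hid (by rw [sum_mul_gate, hm])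

end LawDec
end Quant
end Summit.CriticalPhenomena.PercolationContinuityZ3.Theorems
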